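import Summits.QuantumFields.BalabanUV.T4Continuum.Support.B13AssemblyCoresEndRestrict
import Summits.QuantumFields.BalabanUV.T4Continuum.Support.SubstrateSlotsOfRecord

/-!
# B13AssemblyCoresEndRestrictRecord — row O1-d2-ii «act instance», follower: THE (2.14)-FACTOR-CORE END OF RECORD **STATED AT THE SUBSTRATE's
# SLOTS OF RECORD** `SubstrateSlotsOfRecord.slotsOfRecord` (p220104; MAP §O1 O-8) — `hact` BY `rfl`, the factor letters READ as the substrate's
# `gaussN ∕ gaussQ ∘ linForm` (p219426) BY `rfl`, the weight-letter sign discharged; conclusion about THE INSTANCE's OWN OUTPUTS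
# `B13StepOfRecord.outA ∕ outB (slotsOfRecord …) E₀ cB` (cell `pub-balaban`, T⁴ fan-out, `HOME/BINDER-OWNERS.md` row NE5; unit
# `b2b-balaban-t4-ne5-formalise-leaf-08`, gen 5; journal OFFER l.14470 → INTENT #2; socket-fit note `F-ne5leaf08g5-1`)

HONEST FRAMING (T4-DAG PAGE 1).  Rung (B)+1 on ONE finite four-torus of fixed physical size — NOT infinite volume, NOT a mass gap, NOT
the Clay problem; `FlowStep.BetaPertH`, (B), (B^μ) do not occur here.  NE5 (`T4OutputRate.NE5`) is NOT PRINTED and NOT PROVED (spine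
0/9, unchanged): the END below is an IMPLICATION from displayed binders — «NE5 ⇐ the instance» (trigger c5), NOT «NE5 proved».  The O1
INSTANCE is the SUBSTRATE cell's (Q-NE9-O1, DESIGN RULE R34); this file APPLIES a landed END face BY NAME at it (CLAIM RULE 3: not re-wiring)
and discharges NOTHING of the substrate's letters: which tables `base ∕ rd ∕ coords` realise `C^{(k)}(Z₀,σ)`, `Γ_k` of [Balaban1988RG2Cluster]
(2.14) p. 15, and the smallness making `gaussN ∘ linForm` holomorphic and bounded on the operator balls (`SubstrateGaussianLettersBall`), stay
the substrate's.  0 cite tags; printed KIND only.  HONEST DEPENDENCY (cell, verbatim): continuum YM on T⁴ ⇐ BetaPertH ∧ nine spine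
estimates (0/9 proved); BetaPertH ⇐ (D1) ∧ (D4) ∧ CAP+tail; G-an2-4 gates asym, D1 and NE2/3/4.

WHAT THIS MODULE IS (bookkeeping ∕ [folklore]; `rfl`s + two applications BY NAME; no estimate):
* §1 `coresRec … L` := `SubstrateActivities.coreOf` at `SubstrateSlotsOfRecord.coreLettersOf … L.A` — the substrate's (2.14)-cores of record
  (over the FULL datum space `OpDatum (SpeciesRec …)`); `slotsOfRecord_act_eq_actOfCores` (`rfl` — the END's `hact`), `coresRec_N ∕ _q ∕ _lam`
  (`rfl`: the letters ARE `gaussN ∕ gaussQ ∘ linForm` at the factor's tables, the parameter measure is `lamJ`), `coresRec_wB_nonneg`.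
* §2 **`ne5_slotsOfRecord_cores_actNorm`** — `B13AssemblyCoresEndRestrict.ne5_of_record_cores_actNorm` (the diamond through `restrict`) AT
  `S₀ := slotsOfRecord …`, `𝔠 := coresRec …`, `hact := rfl`, `hwB` discharged; every other binder VERBATIM (factor letters on the sub-slot balls
  about run B's datum of record `opOf (slotsOfRecord …).F (slotsOfRecord …).rawB g U k`, read at `(o : OpDatum _)` — they ARE the substrate's
  `gaussN ∕ gaussQ ∘ linForm` clauses by `coresRec_N ∕ _q`); conclusion LITERALLY
  `T4OutputRate.NE5 (B13StepOfRecord.outA (slotsOfRecord …) E₀ cB) (B13StepOfRecord.outB (slotsOfRecord …) E₀ cB) W κ θ′ C₅`, SAME `C₅`.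
* §3 **`exists_ne5_slotsOfRecord_cores_actNorm`** — the chained face (arithmetic letters eliminated) the same way.
STATUS (census, Edison rule).  DISPLAYED at the instance: the transport reading, the slice budgets (W3 side), the levels L05∕L06 of the
instance's outputs, W1 in row NE2's entry currency + floor, W4, rooms, the factor letters in the substrate's currency (`gaussN ∕ gaussQ ∘ linForm`:
measurability ∕ holomorphy ∕ bound ∕ margin on the sub-slot balls), the history radius, the stripped majorant `A′` with its decay split and
anchored norm `Φ′`, sizes; the sub-slot `M` (of record `↥measOp`) with its two membership side conditions.  NOTHING of Bałaban's (2.14) data is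
asserted; 0/12 leaves; NE5 NOT PROVED; spine 0/9; rung (B)+1 finite T⁴; NOT infinite volume ∕ mass gap ∕ Clay.  0 sorry; axioms ⊆ {propext,
Classical.choice, Quot.sound}.
-/

noncomputable section

open scoped BigOperators
open Metric MeasureTheory

namespace Summit.QuantumFields.BalabanUV.T4Continuum.B13AssemblyCoresEndRestrictRecord

open Literature.MathematicalPhysics.QuantumFieldTheory.Balaban1983to89
open Literature.MathematicalPhysics.QuantumFieldTheory.Balaban1983to89.T4OutputRate (Carriers Functional DecayBound NE5)
open Summit.QuantumFields.BalabanUV.T4Continuum.B13OpDatum (OpDatum)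
open Summit.QuantumFields.BalabanUV.T4Continuum.B13OpDatumJunctions (opOf RawBounded WeightedEntrywiseRate)
open Summit.QuantumFields.BalabanUV.T4Continuum.B13StepTermLabels (TermIdx InnerLabel)
open Summit.QuantumFields.BalabanUV.T4Continuum.B13InnerData (Bnd b13InnerData)
open Summit.QuantumFields.BalabanUV.T4Continuum.B13HistMeasurable (MeasPotFrame B13HistM)
open Summit.QuantumFields.BalabanUV.T4Continuum.B13TermRep (actMajorant)
open Summit.QuantumFields.BalabanUV.T4Continuum.B13TermParamGaussianBi (BiCore)
open Summit.QuantumFields.BalabanUV.T4Continuum.B13TermContours (lamJ wBJ radii wBJ_nonneg radii_nonneg)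
open Summit.QuantumFields.BalabanUV.T4Continuum.B13TermCoreFamily (actOfCores factorCores)
open Summit.QuantumFields.BalabanUV.T4Continuum.B13TermCoreMass (factorMass)
open Summit.QuantumFields.BalabanUV.T4Continuum.UrsellTreeSum (ind)
open Summit.QuantumFields.BalabanUV.T4Continuum.UrsellTermBudget (actSum)
open Summit.QuantumFields.BalabanUV.T4Continuum.B13DomainGeometryTR (SCube footprint)
open Summit.QuantumFields.BalabanUV.T4Continuum.B13StepOfRecord (Slots assembly step)
open Summit.QuantumFields.BalabanUV.T4Continuum.SubstrateTwoRunsDriven (DrivenRuns)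
open Summit.QuantumFields.BalabanUV.T4Continuum.SubstrateActivities (coreOf)
open Summit.QuantumFields.BalabanUV.T4Continuum.SubstrateGaussianLetters (gaussN gaussQ linForm)
open Summit.QuantumFields.BalabanUV.T4Continuum.SubstrateSlotsOfRecord (SpeciesRec SlotLetters coreLettersOf slotsOfRecord)
open Summit.QuantumFields.BalabanUV.T4Continuum.B13AssemblyCoresEndRestrict (ne5_of_record_cores_actNorm exists_ne5_of_record_cores_actNorm)

variable {G : Type} [GaugeGroup G] (D : DrivenRuns G)
variable {o : Type} [Fintype o] [DecidableEq o] (ι : G →* Matrix o o ℂ) (c : ℂ) (a : ℝ) (s : ℕ → ℂ)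
variable {T ι' S Ω 𝒴 : Type} (P : MeasPotFrame D.carriers) {IOp : Type*}
  (𝒵 : D.carriers.Dom → InnerLabel D.carriers.Dom (Bnd D.toTwoRuns) → Type) [∀ Z j, Fintype (𝒵 Z j)] (dom : ∀ Z j, 𝒵 Z j → D.carriers.Dom)
  (Jc : D.carriers.Dom → InnerLabel D.carriers.Dom (Bnd D.toTwoRuns) → Type) [∀ Z j, Fintype (Jc Z j)]
  (V : D.carriers.Dom → InnerLabel D.carriers.Dom (Bnd D.toTwoRuns) → Type) [∀ Z j, NormedAddCommGroup (V Z j)]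
  [∀ Z j, InnerProductSpace ℝ (V Z j)] [∀ Z j, MeasurableSpace (V Z j)] [∀ Z j, BorelSpace (V Z j)] [∀ Z j, FiniteDimensional ℝ (V Z j)]
  (mI : D.carriers.Dom → InnerLabel D.carriers.Dom (Bnd D.toTwoRuns) → Type) [∀ Z j, Fintype (mI Z j)] [∀ Z j, DecidableEq (mI Z j)]
  (L : SlotLetters D (o := o) (T := T) (ι' := ι') (S := S) (Ω := Ω) (𝒴 := 𝒴) P (IOp := IOp) 𝒵 dom Jc V mI)

/-! ## §1 The substrate's (2.14)-cores of record and their letters (`rfl` views) -/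

/-- [folklore] **THE (2.14)-CORES OF RECORD**: NE5's concrete-contour cores at the substrate's core letters of record (`coreOf` ∘ `coreLettersOf`),
over the full datum space `OpDatum (SpeciesRec …)` — an abbreviation; `(slotsOfRecord …).act = actOfCores (coresRec …)` by `rfl` (below). -/
abbrev coresRec : ∀ Z j, BiCore P (dom Z j) (OpDatum (SpeciesRec D o T ι' Ω 𝒴)) ((Jc Z j ⊕ 𝒵 Z j) → ℝ × ℝ) (V Z j) :=
  coreOf P (OpDatum (SpeciesRec D o T ι' Ω 𝒴)) 𝒵 dom Jc V (coreLettersOf D P _ 𝒵 dom Jc V mI L.A)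

/-- [folklore] **THE END's `hact` AT THE SLOTS OF RECORD IS `rfl`**: the activity slot of record IS `actOfCores` of the cores of record. -/
theorem slotsOfRecord_act_eq_actOfCores : (slotsOfRecord D ι c a s P 𝒵 dom Jc V mI L).act = actOfCores (coresRec D P 𝒵 dom Jc V mI L) := rfl

omit [Fintype o] [DecidableEq o] [∀ Z j, BorelSpace (V Z j)] [∀ Z j, FiniteDimensional ℝ (V Z j)] in
/-- [folklore] The normalisation letter of a core of record IS the substrate's `gaussN ∘ linForm` at the factor's tables (`rfl`). -/
theorem coresRec_N (Z : D.carriers.Dom) (j : InnerLabel D.carriers.Dom (Bnd D.toTwoRuns)) (op : OpDatum (SpeciesRec D o T ι' Ω 𝒴))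
    (p : (Jc Z j ⊕ 𝒵 Z j) → ℝ × ℝ) : (coresRec D P 𝒵 dom Jc V mI L Z j).N op p = gaussN (linForm (L.A Z j).base (L.A Z j).rd) op p := rfl

omit [Fintype o] [DecidableEq o] [∀ Z j, BorelSpace (V Z j)] [∀ Z j, FiniteDimensional ℝ (V Z j)] in
/-- [folklore] The exponent letter of a core of record IS the substrate's `gaussQ ∘ linForm` in the factor's flat coordinates (`rfl`). -/
theorem coresRec_q (Z : D.carriers.Dom) (j : InnerLabel D.carriers.Dom (Bnd D.toTwoRuns)) (op : OpDatum (SpeciesRec D o T ι' Ω 𝒴))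
    (p : (Jc Z j ⊕ 𝒵 Z j) → ℝ × ℝ) (v : V Z j) :
    (coresRec D P 𝒵 dom Jc V mI L Z j).q op p v = gaussQ (linForm (L.A Z j).base (L.A Z j).rd) (L.A Z j).coords op p v := rfl

omit [Fintype o] [DecidableEq o] [∀ Z j, BorelSpace (V Z j)] [∀ Z j, FiniteDimensional ℝ (V Z j)] in
/-- [folklore] The parameter measure of a core of record is NE5's product contour measure `lamJ` (`rfl`). -/
theorem coresRec_lam (Z : D.carriers.Dom) (j : InnerLabel D.carriers.Dom (Bnd D.toTwoRuns)) :
    (coresRec D P 𝒵 dom Jc V mI L Z j).lam = lamJ (Jc Z j ⊕ 𝒵 Z j) := rfl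

omit [Fintype o] [DecidableEq o] [∀ Z j, BorelSpace (V Z j)] [∀ Z j, FiniteDimensional ℝ (V Z j)] in
/-- [folklore] **THE WEIGHT-LETTER SIGN IS DISCHARGED**: `0 ≤ (coresRec … Z j).wB` (the explicit product `wBJ (radii κ₁ r)` of
`B13TermContourCore.ofContours`, nonnegative since `κ₁ > 0`, `r Y > 1`). -/
theorem coresRec_wB_nonneg (Z : D.carriers.Dom) (j : InnerLabel D.carriers.Dom (Bnd D.toTwoRuns)) :
    0 ≤ (coresRec D P 𝒵 dom Jc V mI L Z j).wB :=
  wBJ_nonneg (radii_nonneg (L.A Z j).κ₁_pos (L.A Z j).one_lt_r)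

/-! ## §2 The diamond of record at the slots of record -/

section End

variable (M : Submodule ℂ (OpDatum (SpeciesRec D o T ι' Ω 𝒴)))
  (hMA : ∀ g W k, opOf (slotsOfRecord D ι c a s P 𝒵 dom Jc V mI L).F (slotsOfRecord D ι c a s P 𝒵 dom Jc V mI L).rawA g W k ∈ M)
  (hMB : ∀ g U k, opOf (slotsOfRecord D ι c a s P 𝒵 dom Jc V mI L).F (slotsOfRecord D ι c a s P 𝒵 dom Jc V mI L).rawB g U k ∈ M)
  (E₀ cB : ℝ)

include hMA in
/-- [folklore] **THE (2.14)-FACTOR-CORE END OF RECORD AT THE SUBSTRATE's SLOTS OF RECORD** — `B13AssemblyCoresEndRestrict.ne5_of_record_cores_actNorm`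
at `S₀ := slotsOfRecord …`, `𝔠 := coresRec …`, `hact := rfl`, `hwB := coresRec_wB_nonneg`.  Binders (all DISPLAYED, in leaf-04-g3's order): the
transport reading, the slice budgets, the levels of the instance's outputs, W1 in row NE2's entry currency + floor, W4, rooms, the factor
letters (= the substrate's `gaussN ∕ gaussQ ∘ linForm` clauses on the sub-slot balls about run B's datum of record, by `coresRec_N ∕ _q`), the
history radius, `A′` ∕ decay split ∕ `Φ′`, sizes.  Conclusion LITERALLY `T4OutputRate.NE5 (B13StepOfRecord.outA (slotsOfRecord …) E₀ cB)
(B13StepOfRecord.outB (slotsOfRecord …) E₀ cB) W κ θ′ C₅`.  «NE5 ⇐ the instance» — NOT NE5 proved; no letter of the substrate discharged. -/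
theorem ne5_slotsOfRecord_cores_actNorm {W : Set (ℕ → ℝ)} {ROp RHist R' H : ℕ → ℝ}
    {N₀f mf bf : D.carriers.Dom → InnerLabel D.carriers.Dom (Bnd D.toTwoRuns) → ℝ}
    {A' : ℕ → D.carriers.Dom → InnerLabel D.carriers.Dom (Bnd D.toTwoRuns) → ℝ}
    {mstar κ Φ' EA₀ E₁ cA c₁ r₀ δ' θ θ' ρ₀ B : ℝ} {k₀ : ℕ}
    (hT : (assembly (slotsOfRecord D ι c a s P 𝒵 dom Jc V mI L)).TransportReads W)
    (hbB : (assembly (slotsOfRecord D ι c a s P 𝒵 dom Jc V mI L)).SliceBudgetB W κ cB)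
    (hbA : (slotsOfRecord D ι c a s P 𝒵 dom Jc V mI L).D.SliceBudget (step (slotsOfRecord D ι c a s P 𝒵 dom Jc V mI L) E₀ cB) W κ cA)
    (hdA : DecayBound (B13StepOfRecord.outA (slotsOfRecord D ι c a s P 𝒵 dom Jc V mI L) E₀ cB) W EA₀ κ)
    (hdB : DecayBound (B13StepOfRecord.outB (slotsOfRecord D ι c a s P 𝒵 dom Jc V mI L) E₀ cB) W E₀ κ)
    (hRA : RawBounded (slotsOfRecord D ι c a s P 𝒵 dom Jc V mI L).F (assembly (slotsOfRecord D ι c a s P 𝒵 dom Jc V mI L)).rawAt W)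
    (hRB : RawBounded (slotsOfRecord D ι c a s P 𝒵 dom Jc V mI L).F (slotsOfRecord D ι c a s P 𝒵 dom Jc V mI L).rawB W)
    (hwer : WeightedEntrywiseRate (slotsOfRecord D ι c a s P 𝒵 dom Jc V mI L).F (assembly (slotsOfRecord D ι c a s P 𝒵 dom Jc V mI L)).rawAt
      (slotsOfRecord D ι c a s P 𝒵 dom Jc V mI L).rawB W c₁ fun k => θ ^ k)
    (hfl : ∀ k, r₀ ≤ (slotsOfRecord D ι c a s P 𝒵 dom Jc V mI L).rOp k)
    (hins : (step (slotsOfRecord D ι c a s P 𝒵 dom Jc V mI L) E₀ cB).InsertionRate W κ E₀ δ' θ)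
    (hOp : ∀ k, (slotsOfRecord D ι c a s P 𝒵 dom Jc V mI L).rOp k ≤ ROp k) (hroom : ∀ k, ROp k < R' k)
    (hHist : ∀ k, (assembly (slotsOfRecord D ι c a s P 𝒵 dom Jc V mI L)).bHist E₀ cB k + (slotsOfRecord D ι c a s P 𝒵 dom Jc V mI L).rHist k ≤
      RHist k)
    -- the factor letters in the substrate's currency (by `coresRec_N ∕ _q` these ARE `gaussN ∕ gaussQ ∘ linForm` clauses)
    (hm : 0 < mstar) (hmf : ∀ Z ℓ, mstar ≤ mf Z ℓ) (hN₀ : ∀ Z ℓ, 0 ≤ N₀f Z ℓ)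
    (hNf : ∀ k, ∀ g ∈ W, ∀ (U : D.carriers.BgB) (X : D.carriers.Dom), D.carriers.scale X = k →
      ∀ i, (assembly (slotsOfRecord D ι c a s P 𝒵 dom Jc V mI L)).𝒯.Rel k i X →
      ∀ m : Fin ((assembly (slotsOfRecord D ι c a s P 𝒵 dom Jc V mI L)).𝒯.len i + 1),
      (∀ op ∈ ball (⟨opOf (slotsOfRecord D ι c a s P 𝒵 dom Jc V mI L).F (slotsOfRecord D ι c a s P 𝒵 dom Jc V mI L).rawB g U k,
          hMB g U k⟩ : M) (R' k),
        AEStronglyMeasurable ((factorCores (assembly (slotsOfRecord D ι c a s P 𝒵 dom Jc V mI L)).𝒯 (coresRec D P 𝒵 dom Jc V mI L) i m).N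
          (op : OpDatum _)) (factorCores (assembly (slotsOfRecord D ι c a s P 𝒵 dom Jc V mI L)).𝒯 (coresRec D P 𝒵 dom Jc V mI L) i m).lam) ∧
      (∀ p, DifferentiableOn ℂ (fun op : M =>
          (factorCores (assembly (slotsOfRecord D ι c a s P 𝒵 dom Jc V mI L)).𝒯 (coresRec D P 𝒵 dom Jc V mI L) i m).N (op : OpDatum _) p)
        (ball (⟨opOf (slotsOfRecord D ι c a s P 𝒵 dom Jc V mI L).F (slotsOfRecord D ι c a s P 𝒵 dom Jc V mI L).rawB g U k,
          hMB g U k⟩ : M) (R' k))) ∧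
      (∀ op ∈ ball (⟨opOf (slotsOfRecord D ι c a s P 𝒵 dom Jc V mI L).F (slotsOfRecord D ι c a s P 𝒵 dom Jc V mI L).rawB g U k,
          hMB g U k⟩ : M) (R' k), ∀ p,
        ‖(factorCores (assembly (slotsOfRecord D ι c a s P 𝒵 dom Jc V mI L)).𝒯 (coresRec D P 𝒵 dom Jc V mI L) i m).N (op : OpDatum _) p‖ ≤
          N₀f ((assembly (slotsOfRecord D ι c a s P 𝒵 dom Jc V mI L)).𝒯.poly i m)
            ((assembly (slotsOfRecord D ι c a s P 𝒵 dom Jc V mI L)).𝒯.lab i m)))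
    (hqf : ∀ k, ∀ g ∈ W, ∀ (U : D.carriers.BgB) (X : D.carriers.Dom), D.carriers.scale X = k →
      ∀ i, (assembly (slotsOfRecord D ι c a s P 𝒵 dom Jc V mI L)).𝒯.Rel k i X →
      ∀ m : Fin ((assembly (slotsOfRecord D ι c a s P 𝒵 dom Jc V mI L)).𝒯.len i + 1),
      (∀ op ∈ ball (⟨opOf (slotsOfRecord D ι c a s P 𝒵 dom Jc V mI L).F (slotsOfRecord D ι c a s P 𝒵 dom Jc V mI L).rawB g U k,
          hMB g U k⟩ : M) (R' k),
        AEStronglyMeasurable (Function.uncurry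
          ((factorCores (assembly (slotsOfRecord D ι c a s P 𝒵 dom Jc V mI L)).𝒯 (coresRec D P 𝒵 dom Jc V mI L) i m).q (op : OpDatum _)))
          ((factorCores (assembly (slotsOfRecord D ι c a s P 𝒵 dom Jc V mI L)).𝒯 (coresRec D P 𝒵 dom Jc V mI L) i m).lam.prod volume)) ∧
      (∀ p v, DifferentiableOn ℂ (fun op : M =>
          (factorCores (assembly (slotsOfRecord D ι c a s P 𝒵 dom Jc V mI L)).𝒯 (coresRec D P 𝒵 dom Jc V mI L) i m).q (op : OpDatum _) p v)
        (ball (⟨opOf (slotsOfRecord D ι c a s P 𝒵 dom Jc V mI L).F (slotsOfRecord D ι c a s P 𝒵 dom Jc V mI L).rawB g U k,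
          hMB g U k⟩ : M) (R' k))) ∧
      (∀ op ∈ ball (⟨opOf (slotsOfRecord D ι c a s P 𝒵 dom Jc V mI L).F (slotsOfRecord D ι c a s P 𝒵 dom Jc V mI L).rawB g U k,
          hMB g U k⟩ : M) (R' k), ∀ p v,
        mf ((assembly (slotsOfRecord D ι c a s P 𝒵 dom Jc V mI L)).𝒯.poly i m) ((assembly (slotsOfRecord D ι c a s P 𝒵 dom Jc V mI L)).𝒯.lab i m) *
            ‖v‖ ^ 2 -
          bf ((assembly (slotsOfRecord D ι c a s P 𝒵 dom Jc V mI L)).𝒯.poly i m) ((assembly (slotsOfRecord D ι c a s P 𝒵 dom Jc V mI L)).𝒯.lab i m) ≤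
          ((factorCores (assembly (slotsOfRecord D ι c a s P 𝒵 dom Jc V mI L)).𝒯 (coresRec D P 𝒵 dom Jc V mI L) i m).q (op : OpDatum _) p v).re))
    (hH : ∀ k, ∀ g ∈ W, ∀ U : D.carriers.BgB, ‖(assembly (slotsOfRecord D ι c a s P 𝒵 dom Jc V mI L)).histRef g U k‖ + RHist k ≤ H k)
    -- the stripped majorant's decay split and anchored exponential norm
    (hκ : 0 ≤ κ) (hA0' : ∀ k Z ℓ, 0 ≤ A' k Z ℓ)
    (hdec : ∀ k Z ℓ, factorMass (coresRec D P 𝒵 dom Jc V mI L) N₀f bf mstar (H k) Z ℓ ≤ A' k Z ℓ * Real.exp (-(κ * (D.carriers.d Z + 5))))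
    (hΦ0 : 0 ≤ Φ') (hsmallΦ : 36 * Φ' < 1)
    (hΦ : ∀ (k : ℕ) (q : SCube D.toTwoRuns), ∑ Z ∈ D.toTwoRuns.domAt k,
      ind (q ∈ footprint Z) * actSum (b13InnerData D.toTwoRuns) (A' k) k Z * Real.exp ((footprint Z).card) ≤ Φ')
    (hE₀ : 0 ≤ E₀) (hE₁ : 0 < E₁) (hcA : 0 ≤ cA) (hcB : 0 ≤ cB) (hc₁ : 0 ≤ c₁) (hr₀ : 0 < r₀) (hδ' : 0 ≤ δ')
    (hθ : 0 ≤ θ) (hθθ' : θ ≤ θ') (hθ'1 : θ' ≤ 1) (hω : 0 < (slotsOfRecord D ι c a s P 𝒵 dom Jc V mI L).D.ω)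
    (hω1 : (slotsOfRecord D ι c a s P 𝒵 dom Jc V mI L).D.ω < 1) (hρ₀ : ρ₀ < 1)
    (hnear : (c₁ / r₀ + δ') * θ ^ k₀ + cA * (EA₀ + E₀) / (1 - (slotsOfRecord D ι c a s P 𝒵 dom Jc V mI L).D.ω) ≤ ρ₀) (hB : 0 ≤ B)
    (hfirst : ∀ k < k₀, EA₀ + E₀ ≤ B * θ ^ k)
    (hsmall : (slotsOfRecord D ι c a s P 𝒵 dom Jc V mI L).D.ω + Φ' / (1 - 36 * Φ') / (1 - ρ₀) * cA < θ') :
    NE5 (B13StepOfRecord.outA (slotsOfRecord D ι c a s P 𝒵 dom Jc V mI L) E₀ cB)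
      (B13StepOfRecord.outB (slotsOfRecord D ι c a s P 𝒵 dom Jc V mI L) E₀ cB) W κ θ'
      ((Φ' / (1 - 36 * Φ') / (1 - ρ₀) * (c₁ / r₀) + Φ' / (1 - 36 * Φ') / (1 - ρ₀) * δ' + B) *
        (θ' - (slotsOfRecord D ι c a s P 𝒵 dom Jc V mI L).D.ω) /
        (θ' - ((slotsOfRecord D ι c a s P 𝒵 dom Jc V mI L).D.ω + Φ' / (1 - 36 * Φ') / (1 - ρ₀) * cA))) :=
  ne5_of_record_cores_actNorm (slotsOfRecord D ι c a s P 𝒵 dom Jc V mI L) M hMA hMB (coresRec D P 𝒵 dom Jc V mI L) E₀ cB rfl hT hbB hbA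
    hdA hdB hRA hRB hwer hfl hins hOp hroom hHist hm hmf (coresRec_wB_nonneg D P 𝒵 dom Jc V mI L) hN₀ hNf hqf hH hκ hA0' hdec hΦ0 hsmallΦ
    hΦ hE₀ hE₁ hcA hcB hc₁ hr₀ hδ' hθ hθθ' hθ'1 hω hω1 hρ₀ hnear hB hfirst hsmall

/-! ## §3 The chained face at the slots of record -/

include hMA in
/-- [folklore] **THE CHAINED END OF RECORD AT THE SUBSTRATE's SLOTS OF RECORD** — `B13AssemblyCoresEndRestrict.exists_ne5_of_record_cores_actNorm`
(arithmetic letters eliminated: `0 < θ < 1`, `cA(EA₀ + E₀) < 1 − ω`, `ω + (Φ′∕(1 − 36Φ′))·cA·(1 − ω)∕(1 − ω − cA(EA₀ + E₀)) < θ′`) at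
`S₀ := slotsOfRecord …`, `𝔠 := coresRec …`, `hact := rfl`, `hwB` discharged ⟹
`∃ C₅, NE5 (B13StepOfRecord.outA (slotsOfRecord …) E₀ cB) (B13StepOfRecord.outB (slotsOfRecord …) E₀ cB) W κ θ′ C₅`.  «NE5 ⇐ the instance». -/
theorem exists_ne5_slotsOfRecord_cores_actNorm {W : Set (ℕ → ℝ)} {ROp RHist R' H : ℕ → ℝ}
    {N₀f mf bf : D.carriers.Dom → InnerLabel D.carriers.Dom (Bnd D.toTwoRuns) → ℝ}
    {A' : ℕ → D.carriers.Dom → InnerLabel D.carriers.Dom (Bnd D.toTwoRuns) → ℝ}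
    {mstar κ Φ' EA₀ cA c₁ r₀ δ' θ θ' : ℝ}
    (hT : (assembly (slotsOfRecord D ι c a s P 𝒵 dom Jc V mI L)).TransportReads W)
    (hbB : (assembly (slotsOfRecord D ι c a s P 𝒵 dom Jc V mI L)).SliceBudgetB W κ cB)
    (hbA : (slotsOfRecord D ι c a s P 𝒵 dom Jc V mI L).D.SliceBudget (step (slotsOfRecord D ι c a s P 𝒵 dom Jc V mI L) E₀ cB) W κ cA)
    (hdA : DecayBound (B13StepOfRecord.outA (slotsOfRecord D ι c a s P 𝒵 dom Jc V mI L) E₀ cB) W EA₀ κ)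
    (hdB : DecayBound (B13StepOfRecord.outB (slotsOfRecord D ι c a s P 𝒵 dom Jc V mI L) E₀ cB) W E₀ κ)
    (hRA : RawBounded (slotsOfRecord D ι c a s P 𝒵 dom Jc V mI L).F (assembly (slotsOfRecord D ι c a s P 𝒵 dom Jc V mI L)).rawAt W)
    (hRB : RawBounded (slotsOfRecord D ι c a s P 𝒵 dom Jc V mI L).F (slotsOfRecord D ι c a s P 𝒵 dom Jc V mI L).rawB W)
    (hwer : WeightedEntrywiseRate (slotsOfRecord D ι c a s P 𝒵 dom Jc V mI L).F (assembly (slotsOfRecord D ι c a s P 𝒵 dom Jc V mI L)).rawAt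
      (slotsOfRecord D ι c a s P 𝒵 dom Jc V mI L).rawB W c₁ fun k => θ ^ k)
    (hfl : ∀ k, r₀ ≤ (slotsOfRecord D ι c a s P 𝒵 dom Jc V mI L).rOp k)
    (hins : (step (slotsOfRecord D ι c a s P 𝒵 dom Jc V mI L) E₀ cB).InsertionRate W κ E₀ δ' θ)
    (hOp : ∀ k, (slotsOfRecord D ι c a s P 𝒵 dom Jc V mI L).rOp k ≤ ROp k) (hroom : ∀ k, ROp k < R' k)
    (hHist : ∀ k, (assembly (slotsOfRecord D ι c a s P 𝒵 dom Jc V mI L)).bHist E₀ cB k + (slotsOfRecord D ι c a s P 𝒵 dom Jc V mI L).rHist k ≤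
      RHist k)
    (hm : 0 < mstar) (hmf : ∀ Z ℓ, mstar ≤ mf Z ℓ) (hN₀ : ∀ Z ℓ, 0 ≤ N₀f Z ℓ)
    (hNf : ∀ k, ∀ g ∈ W, ∀ (U : D.carriers.BgB) (X : D.carriers.Dom), D.carriers.scale X = k →
      ∀ i, (assembly (slotsOfRecord D ι c a s P 𝒵 dom Jc V mI L)).𝒯.Rel k i X →
      ∀ m : Fin ((assembly (slotsOfRecord D ι c a s P 𝒵 dom Jc V mI L)).𝒯.len i + 1),
      (∀ op ∈ ball (⟨opOf (slotsOfRecord D ι c a s P 𝒵 dom Jc V mI L).F (slotsOfRecord D ι c a s P 𝒵 dom Jc V mI L).rawB g U k,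
          hMB g U k⟩ : M) (R' k),
        AEStronglyMeasurable ((factorCores (assembly (slotsOfRecord D ι c a s P 𝒵 dom Jc V mI L)).𝒯 (coresRec D P 𝒵 dom Jc V mI L) i m).N
          (op : OpDatum _)) (factorCores (assembly (slotsOfRecord D ι c a s P 𝒵 dom Jc V mI L)).𝒯 (coresRec D P 𝒵 dom Jc V mI L) i m).lam) ∧
      (∀ p, DifferentiableOn ℂ (fun op : M =>
          (factorCores (assembly (slotsOfRecord D ι c a s P 𝒵 dom Jc V mI L)).𝒯 (coresRec D P 𝒵 dom Jc V mI L) i m).N (op : OpDatum _) p)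
        (ball (⟨opOf (slotsOfRecord D ι c a s P 𝒵 dom Jc V mI L).F (slotsOfRecord D ι c a s P 𝒵 dom Jc V mI L).rawB g U k,
          hMB g U k⟩ : M) (R' k))) ∧
      (∀ op ∈ ball (⟨opOf (slotsOfRecord D ι c a s P 𝒵 dom Jc V mI L).F (slotsOfRecord D ι c a s P 𝒵 dom Jc V mI L).rawB g U k,
          hMB g U k⟩ : M) (R' k), ∀ p,
        ‖(factorCores (assembly (slotsOfRecord D ι c a s P 𝒵 dom Jc V mI L)).𝒯 (coresRec D P 𝒵 dom Jc V mI L) i m).N (op : OpDatum _) p‖ ≤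
          N₀f ((assembly (slotsOfRecord D ι c a s P 𝒵 dom Jc V mI L)).𝒯.poly i m)
            ((assembly (slotsOfRecord D ι c a s P 𝒵 dom Jc V mI L)).𝒯.lab i m)))
    (hqf : ∀ k, ∀ g ∈ W, ∀ (U : D.carriers.BgB) (X : D.carriers.Dom), D.carriers.scale X = k →
      ∀ i, (assembly (slotsOfRecord D ι c a s P 𝒵 dom Jc V mI L)).𝒯.Rel k i X →
      ∀ m : Fin ((assembly (slotsOfRecord D ι c a s P 𝒵 dom Jc V mI L)).𝒯.len i + 1),
      (∀ op ∈ ball (⟨opOf (slotsOfRecord D ι c a s P 𝒵 dom Jc V mI L).F (slotsOfRecord D ι c a s P 𝒵 dom Jc V mI L).rawB g U k,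
          hMB g U k⟩ : M) (R' k),
        AEStronglyMeasurable (Function.uncurry
          ((factorCores (assembly (slotsOfRecord D ι c a s P 𝒵 dom Jc V mI L)).𝒯 (coresRec D P 𝒵 dom Jc V mI L) i m).q (op : OpDatum _)))
          ((factorCores (assembly (slotsOfRecord D ι c a s P 𝒵 dom Jc V mI L)).𝒯 (coresRec D P 𝒵 dom Jc V mI L) i m).lam.prod volume)) ∧
      (∀ p v, DifferentiableOn ℂ (fun op : M =>
          (factorCores (assembly (slotsOfRecord D ι c a s P 𝒵 dom Jc V mI L)).𝒯 (coresRec D P 𝒵 dom Jc V mI L) i m).q (op : OpDatum _) p v)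
        (ball (⟨opOf (slotsOfRecord D ι c a s P 𝒵 dom Jc V mI L).F (slotsOfRecord D ι c a s P 𝒵 dom Jc V mI L).rawB g U k,
          hMB g U k⟩ : M) (R' k))) ∧
      (∀ op ∈ ball (⟨opOf (slotsOfRecord D ι c a s P 𝒵 dom Jc V mI L).F (slotsOfRecord D ι c a s P 𝒵 dom Jc V mI L).rawB g U k,
          hMB g U k⟩ : M) (R' k), ∀ p v,
        mf ((assembly (slotsOfRecord D ι c a s P 𝒵 dom Jc V mI L)).𝒯.poly i m) ((assembly (slotsOfRecord D ι c a s P 𝒵 dom Jc V mI L)).𝒯.lab i m) *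
            ‖v‖ ^ 2 -
          bf ((assembly (slotsOfRecord D ι c a s P 𝒵 dom Jc V mI L)).𝒯.poly i m) ((assembly (slotsOfRecord D ι c a s P 𝒵 dom Jc V mI L)).𝒯.lab i m) ≤
          ((factorCores (assembly (slotsOfRecord D ι c a s P 𝒵 dom Jc V mI L)).𝒯 (coresRec D P 𝒵 dom Jc V mI L) i m).q (op : OpDatum _) p v).re))
    (hH : ∀ k, ∀ g ∈ W, ∀ U : D.carriers.BgB, ‖(assembly (slotsOfRecord D ι c a s P 𝒵 dom Jc V mI L)).histRef g U k‖ + RHist k ≤ H k)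
    (hκ : 0 ≤ κ) (hA0' : ∀ k Z ℓ, 0 ≤ A' k Z ℓ)
    (hdec : ∀ k Z ℓ, factorMass (coresRec D P 𝒵 dom Jc V mI L) N₀f bf mstar (H k) Z ℓ ≤ A' k Z ℓ * Real.exp (-(κ * (D.carriers.d Z + 5))))
    (hΦ0 : 0 ≤ Φ') (hsmallΦ : 36 * Φ' < 1)
    (hΦ : ∀ (k : ℕ) (q : SCube D.toTwoRuns), ∑ Z ∈ D.toTwoRuns.domAt k,
      ind (q ∈ footprint Z) * actSum (b13InnerData D.toTwoRuns) (A' k) k Z * Real.exp ((footprint Z).card) ≤ Φ')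
    (hE₀ : 0 ≤ E₀) (hcA : 0 ≤ cA) (hcB : 0 ≤ cB) (hc₁ : 0 ≤ c₁) (hr₀ : 0 < r₀) (hδ' : 0 ≤ δ')
    (hθ0 : 0 < θ) (hθ1 : θ < 1) (hθθ' : θ ≤ θ') (hθ'1 : θ' ≤ 1) (hω : 0 < (slotsOfRecord D ι c a s P 𝒵 dom Jc V mI L).D.ω)
    (hω1 : (slotsOfRecord D ι c a s P 𝒵 dom Jc V mI L).D.ω < 1)
    (hh : cA * (EA₀ + E₀) < 1 - (slotsOfRecord D ι c a s P 𝒵 dom Jc V mI L).D.ω)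
    (hsmall : (slotsOfRecord D ι c a s P 𝒵 dom Jc V mI L).D.ω + Φ' / (1 - 36 * Φ') * cA * (1 - (slotsOfRecord D ι c a s P 𝒵 dom Jc V mI L).D.ω) /
      (1 - (slotsOfRecord D ι c a s P 𝒵 dom Jc V mI L).D.ω - cA * (EA₀ + E₀)) < θ') :
    ∃ C₅, NE5 (B13StepOfRecord.outA (slotsOfRecord D ι c a s P 𝒵 dom Jc V mI L) E₀ cB)
      (B13StepOfRecord.outB (slotsOfRecord D ι c a s P 𝒵 dom Jc V mI L) E₀ cB) W κ θ' C₅ :=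
  exists_ne5_of_record_cores_actNorm (slotsOfRecord D ι c a s P 𝒵 dom Jc V mI L) M hMA hMB (coresRec D P 𝒵 dom Jc V mI L) E₀ cB rfl hT
    hbB hbA hdA hdB hRA hRB hwer hfl hins hOp hroom hHist hm hmf (coresRec_wB_nonneg D P 𝒵 dom Jc V mI L) hN₀ hNf hqf hH hκ hA0' hdec hΦ0
    hsmallΦ hΦ hE₀ hcA hcB hc₁ hr₀ hδ' hθ0 hθ1 hθθ' hθ'1 hω hω1 hh hsmall

end End

end Summit.QuantumFields.BalabanUV.T4Continuum.B13AssemblyCoresEndRestrictRecord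

end
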